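import Mathlib.MeasureTheory.Integral.IntegralEqImproper
import Mathlib.Analysis.SpecialFunctions.Integrals.Basic
import Mathlib.Analysis.SpecialFunctions.Gaussian.GaussianIntegral
import Literature.Analysis.FluidPDE.GaussianVortexKernelRadial
import Summits.NavierStokesRegularity.NavierStokesRegularity.Theorems.FilamentSkeletonRssCoreLinearInvertibilityOddArnoldToolsA

/-!
# Tools for stub `stub_arnoldModeOne1D` (crux `CoreLinearInvertibility`,
# stmt-NavierStokesRegularity-17973, route `FilamentSkeletonRss`, line `Sketch`) — part A: kernel calculus

One-variable calculus on `(0, ∞)` for the `k = ±1` constrained Arnold coercivity at the Gaussian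
(Gallay–Šverák, arXiv:2110.13739, §2, proof of Thm. 2.5 — here by an elementary trace argument):

* the Gaussian class `|f(r)| ≤ C (1+r)ᴺ e^{−r²/4}` on `[0, ∞)`: absorption of polynomial weights
  (`(1+r)ᴺ e^{−r²/8} ≤ e^{2N²}`), integrability of `rᵏ f`, of the weighted products `Φ⁻¹ f g r`
  (`Φ = kerWeight`, `Φ⁻¹ ≤ e^{r²/4}` — tree `arnold_inv_kerWeight_le`), closure under `c₁ f + c₂ g`;
* explicit integrals: `∫₀^∞ r³ e^{−r²/c} dr = c²/2`, `∫₀ʳ s³ e^{−s²/4} ds = 8 − 2(r²+4)e^{−r²/4}`,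
  `∫ᵣ^∞ s e^{−s²/4} ds = 2e^{−r²/4}`;
* the kernel weight: `Φ⁻¹(r) · r e^{−r²/4} = 4(1 − e^{−r²/4})/r`, `Φ ≤ (r²/4)e^{−r²/4} + e^{−3r²/8}`,
  hence the trace bound `∫₀^∞ r Φ(r) dr ≤ 10/3` (true value `π²/3`), and `∫₀^∞ r³Φ ≤ 32`;
* Gaussian limits at `∞` (`rᵏ e^{−r²/c} → 0`).

Everything is folklore calculus; no definitions are introduced (statements are spelled out).
-/

set_option linter.dupNamespace false

noncomputable section

namespace Summit.NavierStokesRegularity.NavierStokesRegularity.Theorems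

open Set Function Filter MeasureTheory Topology
open Literature.Analysis.FluidPDE

/-! ### The Gaussian class on `[0, ∞)` -/

/-- `(1 + r)ᴺ e^{−r²/8} ≤ e^{2N²}` for `r ≥ 0` (`1 + r ≤ eʳ`, `Nr − r²/8 ≤ 2N²`). [folklore] -/
theorem am1_one_add_pow_mul_exp_le (N : ℕ) {r : ℝ} (hr : 0 ≤ r) :
    (1 + r) ^ N * Real.exp (-(r ^ 2 / 8)) ≤ Real.exp (2 * (N : ℝ) ^ 2) := by
  have h1 : (1 + r) ^ N ≤ Real.exp ((N : ℝ) * r) := by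
    have h := Real.add_one_le_exp r
    rw [add_comm] at h
    calc (1 + r) ^ N ≤ Real.exp r ^ N := pow_le_pow_left₀ (by positivity) h N
      _ = Real.exp ((N : ℝ) * r) := by rw [← Real.exp_nat_mul]
  have h2 : (N : ℝ) * r + -(r ^ 2 / 8) ≤ 2 * (N : ℝ) ^ 2 := by
    nlinarith [sq_nonneg (r - 4 * N)]
  calc (1 + r) ^ N * Real.exp (-(r ^ 2 / 8)) ≤ Real.exp ((N : ℝ) * r) * Real.exp (-(r ^ 2 / 8)) :=
        mul_le_mul_of_nonneg_right h1 (Real.exp_pos _).le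
    _ = Real.exp ((N : ℝ) * r + -(r ^ 2 / 8)) := (Real.exp_add _ _).symm
    _ ≤ Real.exp (2 * (N : ℝ) ^ 2) := Real.exp_le_exp.2 h2

/-- Absorption of polynomial weights: a Gaussian-class `f` satisfies
`rᵏ |f(r)| ≤ |C| e^{2(N+k)²} e^{−r²/8}` on `[0, ∞)`. [folklore] -/
theorem am1_pow_mul_abs_le {f : ℝ → ℝ} {C : ℝ} {N : ℕ}
    (hb : ∀ r, 0 ≤ r → |f r| ≤ C * (1 + r) ^ N * Real.exp (-(r ^ 2 / 4))) (k : ℕ) {r : ℝ}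
    (hr : 0 ≤ r) :
    r ^ k * |f r| ≤ |C| * Real.exp (2 * ((N + k : ℕ) : ℝ) ^ 2) * Real.exp (-(r ^ 2 / 8)) := by
  have h1 : r ^ k ≤ (1 + r) ^ k := pow_le_pow_left₀ hr (by linarith) k
  have h2 : |f r| ≤ |C| * (1 + r) ^ N * Real.exp (-(r ^ 2 / 4)) :=
    (hb r hr).trans (by gcongr; exact le_abs_self C)
  have h3 : Real.exp (-(r ^ 2 / 4)) = Real.exp (-(r ^ 2 / 8)) * Real.exp (-(r ^ 2 / 8)) := by
    rw [← Real.exp_add]; ring_nf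
  have h4 := am1_one_add_pow_mul_exp_le (N + k) hr
  calc r ^ k * |f r| ≤ (1 + r) ^ k * (|C| * (1 + r) ^ N * Real.exp (-(r ^ 2 / 4))) :=
        mul_le_mul h1 h2 (abs_nonneg _) (by positivity)
    _ = |C| * ((1 + r) ^ (N + k) * Real.exp (-(r ^ 2 / 8))) * Real.exp (-(r ^ 2 / 8)) := by
        rw [h3, pow_add]; ring
    _ ≤ |C| * Real.exp (2 * ((N + k : ℕ) : ℝ) ^ 2) * Real.exp (-(r ^ 2 / 8)) := by
        gcongr

/-- The Gaussian `e^{−r²/8}` and `r e^{−r²/8}` are integrable on `(0, ∞)` (Mathlib's Gaussian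
integrability, rewritten). [folklore] -/
theorem am1_integrableOn_exp_neg_sq :
    IntegrableOn (fun r : ℝ => Real.exp (-(r ^ 2 / 8))) (Ioi 0) ∧
      IntegrableOn (fun r : ℝ => r * Real.exp (-(r ^ 2 / 8))) (Ioi 0) := by
  have h8 : (0 : ℝ) < 1 / 8 := by norm_num
  have e : ∀ r : ℝ, Real.exp (-(1 / 8) * r ^ 2) = Real.exp (-(r ^ 2 / 8)) := fun r => by
    congr 1; ring
  refine ⟨((integrable_exp_neg_mul_sq h8).integrableOn.congr_fun (fun r _ => e r)
    measurableSet_Ioi), ((integrable_mul_exp_neg_mul_sq h8).integrableOn.congr_fun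
    (fun r _ => by simp only [e r]) measurableSet_Ioi)⟩

/-- `rᵏ f` is integrable on `(0, ∞)` for a continuous Gaussian-class `f`. [folklore] -/
theorem am1_integrableOn_pow_mul {f : ℝ → ℝ} (hf : Continuous f) {C : ℝ} {N : ℕ}
    (hb : ∀ r, 0 ≤ r → |f r| ≤ C * (1 + r) ^ N * Real.exp (-(r ^ 2 / 4))) (k : ℕ) :
    IntegrableOn (fun r : ℝ => r ^ k * f r) (Ioi 0) := by
  refine Integrable.mono' (am1_integrableOn_exp_neg_sq.1.const_mul
    (|C| * Real.exp (2 * ((N + k : ℕ) : ℝ) ^ 2)))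
    (((continuous_pow k).mul hf).aestronglyMeasurable) ?_
  refine (ae_restrict_iff' measurableSet_Ioi).2 (Eventually.of_forall fun r hr => ?_)
  rw [Real.norm_eq_abs, abs_mul, abs_of_nonneg (pow_nonneg (le_of_lt hr) k)]
  exact am1_pow_mul_abs_le hb k (le_of_lt hr)

/-- `rᵏ |f|` is integrable on `(0, ∞)` for a continuous Gaussian-class `f`. [folklore] -/
theorem am1_integrableOn_pow_mul_abs {f : ℝ → ℝ} (hf : Continuous f) {C : ℝ} {N : ℕ}
    (hb : ∀ r, 0 ≤ r → |f r| ≤ C * (1 + r) ^ N * Real.exp (-(r ^ 2 / 4))) (k : ℕ) :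
    IntegrableOn (fun r : ℝ => r ^ k * |f r|) (Ioi 0) := by
  have h : IntegrableOn (fun r : ℝ => ‖r ^ k * f r‖) (Ioi 0) := (am1_integrableOn_pow_mul hf hb k).norm
  refine IntegrableOn.congr_fun h (fun r hr => ?_) measurableSet_Ioi
  have hk : 0 ≤ r ^ k := pow_nonneg (le_of_lt hr) k
  simp only [Real.norm_eq_abs, abs_mul, abs_of_nonneg hk]

/-- The Gaussian class is stable under linear combinations `c₁ f + c₂ g` (constants
`|c₁||C_f| + |c₂||C_g|`, `max N_f N_g`). [folklore] -/
theorem am1_gc_lin {f g : ℝ → ℝ} {Cf Cg : ℝ} {Nf Ng : ℕ}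
    (hbf : ∀ r, 0 ≤ r → |f r| ≤ Cf * (1 + r) ^ Nf * Real.exp (-(r ^ 2 / 4)))
    (hbg : ∀ r, 0 ≤ r → |g r| ≤ Cg * (1 + r) ^ Ng * Real.exp (-(r ^ 2 / 4))) (c₁ c₂ : ℝ) :
    ∀ r, 0 ≤ r → |c₁ * f r + c₂ * g r| ≤
      (|c₁| * |Cf| + |c₂| * |Cg|) * (1 + r) ^ (max Nf Ng) * Real.exp (-(r ^ 2 / 4)) := by
  intro r hr
  have h1r : (1 : ℝ) ≤ 1 + r := by linarith
  have hf' : |f r| ≤ |Cf| * (1 + r) ^ (max Nf Ng) * Real.exp (-(r ^ 2 / 4)) :=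
    (hbf r hr).trans (by
      gcongr
      · exact le_abs_self _
      · exact le_max_left _ _)
  have hg' : |g r| ≤ |Cg| * (1 + r) ^ (max Nf Ng) * Real.exp (-(r ^ 2 / 4)) :=
    (hbg r hr).trans (by
      gcongr
      · exact le_abs_self _
      · exact le_max_right _ _)
  calc |c₁ * f r + c₂ * g r| ≤ |c₁| * |f r| + |c₂| * |g r| := by
        rw [← abs_mul, ← abs_mul]; exact abs_add_le _ _
    _ ≤ |c₁| * (|Cf| * (1 + r) ^ (max Nf Ng) * Real.exp (-(r ^ 2 / 4))) +
        |c₂| * (|Cg| * (1 + r) ^ (max Nf Ng) * Real.exp (-(r ^ 2 / 4))) := by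
        gcongr
    _ = (|c₁| * |Cf| + |c₂| * |Cg|) * (1 + r) ^ (max Nf Ng) * Real.exp (-(r ^ 2 / 4)) := by ring

/-- The profile `a⋆(r) = r e^{−r²/4}` (the `k = 1` mode of `∂_j G`) is in the Gaussian class with
`C = 1`, `N = 1`. [folklore] -/
theorem am1_gc_aStar : ∀ r : ℝ, 0 ≤ r →
    |r * Real.exp (-(r ^ 2 / 4))| ≤ 1 * (1 + r) ^ 1 * Real.exp (-(r ^ 2 / 4)) := by
  intro r hr
  rw [abs_mul, abs_of_nonneg hr, abs_of_pos (Real.exp_pos _), pow_one, one_mul]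
  gcongr
  linarith

/-! ### The kernel weight against the Gaussian class -/

/-- The weighted products `Φ⁻¹ f g · r` of two continuous Gaussian-class functions are integrable on
`(0, ∞)` (`Φ⁻¹ ≤ e^{r²/4}` eats one Gaussian, the other is left). [folklore] -/
theorem am1_integrableOn_weight_mul_mul {f g : ℝ → ℝ} (hf : Continuous f) (hg : Continuous g)
    {Cf Cg : ℝ} {Nf Ng : ℕ}
    (hbf : ∀ r, 0 ≤ r → |f r| ≤ Cf * (1 + r) ^ Nf * Real.exp (-(r ^ 2 / 4)))
    (hbg : ∀ r, 0 ≤ r → |g r| ≤ Cg * (1 + r) ^ Ng * Real.exp (-(r ^ 2 / 4))) :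
    IntegrableOn (fun r : ℝ => (kerWeight r)⁻¹ * (f r * g r) * r) (Ioi 0) := by
  -- `h r := (1+r)^{Ng} e^{r²/4} g r · r` hmm: we bound `Φ⁻¹ |g| ≤ |Cg| (1+r)^{Ng}` and use `r f`.
  set K : ℝ := |Cf| * Real.exp (2 * ((Nf + (Ng + 1) : ℕ) : ℝ) ^ 2) * |Cg| with hK
  refine Integrable.mono' (am1_integrableOn_exp_neg_sq.1.const_mul K)
    ((((continuous_kerWeight.inv₀ fun r => (kerWeight_pos r).ne').mul (hf.mul hg)).mul
      continuous_id).aestronglyMeasurable) ?_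
  refine (ae_restrict_iff' measurableSet_Ioi).2 (Eventually.of_forall fun r hr => ?_)
  have hr0 : 0 ≤ r := le_of_lt hr
  have hΦ := kerWeight_pos r
  rw [Real.norm_eq_abs, abs_mul, abs_mul, abs_of_pos (inv_pos.2 hΦ), abs_mul, abs_of_nonneg hr0]
  -- `|g r| ≤ |Cg| (1+r)^Ng e^{-r²/4}` and `Φ⁻¹ e^{-r²/4} ≤ 1`
  have hg1 : |g r| ≤ |Cg| * (1 + r) ^ Ng * Real.exp (-(r ^ 2 / 4)) :=
    (hbg r hr0).trans (by gcongr; exact le_abs_self _)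
  have hinv : (kerWeight r)⁻¹ * Real.exp (-(r ^ 2 / 4)) ≤ 1 := by
    have h := arnold_inv_kerWeight_le r
    have h2 : Real.exp (r ^ 2 / 4) * Real.exp (-(r ^ 2 / 4)) = 1 := by
      rw [← Real.exp_add, add_neg_cancel, Real.exp_zero]
    calc (kerWeight r)⁻¹ * Real.exp (-(r ^ 2 / 4)) ≤ Real.exp (r ^ 2 / 4) * Real.exp (-(r ^ 2 / 4)) :=
          mul_le_mul_of_nonneg_right h (Real.exp_pos _).le
      _ = 1 := h2
  -- `(1+r)^Ng r |f r| ≤ |Cf| e^{2(Nf+Ng+1)²} e^{-r²/8}` (as in `am1_pow_mul_abs_le`)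
  have hfg : (1 + r) ^ Ng * (r * |f r|) ≤ |Cf| * Real.exp (2 * ((Nf + (Ng + 1) : ℕ) : ℝ) ^ 2) *
      Real.exp (-(r ^ 2 / 8)) := by
    have h2 : |f r| ≤ |Cf| * (1 + r) ^ Nf * Real.exp (-(r ^ 2 / 4)) :=
      (hbf r hr0).trans (by gcongr; exact le_abs_self _)
    have h3 : Real.exp (-(r ^ 2 / 4)) = Real.exp (-(r ^ 2 / 8)) * Real.exp (-(r ^ 2 / 8)) := by
      rw [← Real.exp_add]; ring_nf
    have h4 := am1_one_add_pow_mul_exp_le (Nf + (Ng + 1)) hr0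
    have h5 : r ≤ (1 + r) ^ 1 := by rw [pow_one]; linarith
    calc (1 + r) ^ Ng * (r * |f r|)
        ≤ (1 + r) ^ Ng * ((1 + r) ^ 1 * (|Cf| * (1 + r) ^ Nf * Real.exp (-(r ^ 2 / 4)))) := by
          gcongr
      _ = |Cf| * ((1 + r) ^ (Nf + (Ng + 1)) * Real.exp (-(r ^ 2 / 8))) * Real.exp (-(r ^ 2 / 8)) := by
          rw [h3, pow_add, pow_add]; ring
      _ ≤ |Cf| * Real.exp (2 * ((Nf + (Ng + 1) : ℕ) : ℝ) ^ 2) * Real.exp (-(r ^ 2 / 8)) := by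
          gcongr
  -- assemble
  calc (kerWeight r)⁻¹ * (|f r| * |g r|) * r
      ≤ (kerWeight r)⁻¹ * (|f r| * (|Cg| * (1 + r) ^ Ng * Real.exp (-(r ^ 2 / 4)))) * r := by
        gcongr
    _ = ((kerWeight r)⁻¹ * Real.exp (-(r ^ 2 / 4))) * ((1 + r) ^ Ng * r * |f r|) * |Cg| := by ring
    _ ≤ 1 * ((1 + r) ^ Ng * r * |f r|) * |Cg| := by gcongr
    _ = |Cg| * ((1 + r) ^ Ng * (r * |f r|)) := by ring
    _ ≤ |Cg| * (|Cf| * Real.exp (2 * ((Nf + (Ng + 1) : ℕ) : ℝ) ^ 2) * Real.exp (-(r ^ 2 / 8))) := by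
        gcongr
    _ = K * Real.exp (-(r ^ 2 / 8)) := by rw [hK]; ring

/-! ### Gaussian limits at infinity and explicit integrals -/

/-- `rᵏ e^{−r²/c} → 0` at `+∞` (`c > 0`). [folklore] -/
theorem am1_tendsto_pow_mul_exp_neg_sq (k : ℕ) {c : ℝ} (hc : 0 < c) :
    Tendsto (fun r : ℝ => r ^ k * Real.exp (-(r ^ 2 / c))) atTop (𝓝 0) := by
  have hhalf : Tendsto (fun x : ℝ => Real.exp (-(1 / 2) * x)) atTop (𝓝 0) := by
    have := Real.tendsto_exp_neg_atTop_nhds_zero.comp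
      (tendsto_id.const_mul_atTop (show (0 : ℝ) < 1 / 2 by norm_num))
    refine this.congr' (Eventually.of_forall fun x => ?_)
    simp [neg_mul]
  have h := (rpow_mul_exp_neg_mul_sq_isLittleO_exp_neg (b := 1 / c) (by positivity) (k : ℝ)).trans_tendsto
    hhalf
  refine h.congr' ?_
  filter_upwards [eventually_ge_atTop (0 : ℝ)] with r hr
  rw [Real.rpow_natCast]
  congr 2
  ring

/-- `d/dρ [−(c/2)(ρ² + c) e^{−ρ²/c}] = ρ³ e^{−ρ²/c}`. [folklore] -/
theorem am1_hasDerivAt_cube_primitive {c : ℝ} (hc : c ≠ 0) (ρ : ℝ) :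
    HasDerivAt (fun ρ : ℝ => -(c / 2) * (ρ ^ 2 + c) * Real.exp (-(ρ ^ 2 / c)))
      (ρ ^ 3 * Real.exp (-(ρ ^ 2 / c))) ρ := by
  have h1 : HasDerivAt (fun ρ : ℝ => -(ρ ^ 2 / c)) (-(2 * ρ / c)) ρ := by
    have h := (hasDerivAt_pow 2 ρ).const_mul (-(1 / c))
    refine (h.congr_of_eventuallyEq (Eventually.of_forall fun x => ?_)).congr_deriv ?_
    · simp only; ring
    · push_cast; ring
  have h2 : HasDerivAt (fun ρ : ℝ => Real.exp (-(ρ ^ 2 / c))) (Real.exp (-(ρ ^ 2 / c)) * (-(2 * ρ / c))) ρ :=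
    (Real.hasDerivAt_exp _).comp ρ h1
  have h3 : HasDerivAt (fun ρ : ℝ => -(c / 2) * (ρ ^ 2 + c)) (-(c / 2) * (2 * ρ)) ρ := by
    have h := ((hasDerivAt_pow 2 ρ).add_const c).const_mul (-(c / 2))
    refine h.congr_deriv ?_
    push_cast; ring
  refine ((h3.mul h2).congr_of_eventuallyEq (Eventually.of_forall fun x => ?_)).congr_deriv ?_
  · simp only [Pi.mul_apply]
  · field_simp
    ring

/-- **`∫₀^∞ ρ³ e^{−ρ²/c} dρ = c²/2`** for `c > 0`, with integrability on `(0, ∞)`. [folklore] -/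
theorem am1_integral_Ioi_pow_three_mul_exp {c : ℝ} (hc : 0 < c) :
    (∫ ρ in Ioi (0 : ℝ), ρ ^ 3 * Real.exp (-(ρ ^ 2 / c))) = c ^ 2 / 2 ∧
      IntegrableOn (fun ρ : ℝ => ρ ^ 3 * Real.exp (-(ρ ^ 2 / c))) (Ioi 0) := by
  have hderiv : ∀ x ∈ Ici (0 : ℝ), HasDerivAt (fun ρ : ℝ => -(c / 2) * (ρ ^ 2 + c) * Real.exp (-(ρ ^ 2 / c)))
      (x ^ 3 * Real.exp (-(x ^ 2 / c))) x := fun x _ => am1_hasDerivAt_cube_primitive hc.ne' x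
  have hpos : ∀ x ∈ Ioi (0 : ℝ), 0 ≤ x ^ 3 * Real.exp (-(x ^ 2 / c)) := fun x hx =>
    mul_nonneg (pow_nonneg (le_of_lt hx) 3) (Real.exp_pos _).le
  have hlim : Tendsto (fun ρ : ℝ => -(c / 2) * (ρ ^ 2 + c) * Real.exp (-(ρ ^ 2 / c))) atTop (𝓝 0) := by
    have h2 := am1_tendsto_pow_mul_exp_neg_sq 2 hc
    have h0 := am1_tendsto_pow_mul_exp_neg_sq 0 hc
    have h := (h2.add (h0.const_mul c)).const_mul (-(c / 2))
    simp only [add_zero, mul_zero] at h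
    refine h.congr' (Eventually.of_forall fun ρ => ?_)
    simp only [pow_zero, one_mul]
    ring
  refine ⟨?_, integrableOn_Ioi_deriv_of_nonneg' hderiv hpos hlim⟩
  rw [integral_Ioi_of_hasDerivAt_of_nonneg' hderiv hpos hlim]
  simp only [pow_two (0:ℝ), mul_zero, zero_add, zero_div, neg_zero, Real.exp_zero, mul_one]
  ring

/-- **`∫₀ʳ s² · (s e^{−s²/4}) ds = 8 − 2(r² + 4) e^{−r²/4}`** (the functional `A` of the profile
`a⋆(s) = s e^{−s²/4}`). [folklore] -/
theorem am1_integral_sq_mul_aStar (r : ℝ) :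
    ∫ s in (0 : ℝ)..r, s ^ 2 * (s * Real.exp (-(s ^ 2 / 4))) =
      8 - 2 * (r ^ 2 + 4) * Real.exp (-(r ^ 2 / 4)) := by
  have hderiv : ∀ x ∈ uIcc 0 r, HasDerivAt (fun ρ : ℝ => -(4 / 2) * (ρ ^ 2 + 4) * Real.exp (-(ρ ^ 2 / 4)))
      (x ^ 2 * (x * Real.exp (-(x ^ 2 / 4)))) x := fun x _ =>
    (am1_hasDerivAt_cube_primitive (c := 4) (by norm_num) x).congr_deriv (by ring)
  have hint : IntervalIntegrable (fun x : ℝ => x ^ 2 * (x * Real.exp (-(x ^ 2 / 4)))) volume 0 r :=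
    (by fun_prop : Continuous fun x : ℝ => x ^ 2 * (x * Real.exp (-(x ^ 2 / 4)))).intervalIntegrable _ _
  rw [intervalIntegral.integral_eq_sub_of_hasDerivAt hderiv hint]
  simp only [pow_two (0:ℝ), mul_zero, zero_add, zero_div, neg_zero, Real.exp_zero, mul_one]
  ring

/-- **`∫ᵣ^∞ s e^{−s²/4} ds = 2 e^{−r²/4}`** for `r ≥ 0` (the functional `B` of `a⋆`; tree
`integral_Ioi_mul_exp_neg_sq_div`, `c = 4`). [folklore] -/
theorem am1_integral_Ioi_aStar {r : ℝ} (hr : 0 ≤ r) :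
    ∫ s in Ioi r, s * Real.exp (-(s ^ 2 / 4)) = 2 * Real.exp (-(r ^ 2 / 4)) := by
  rw [(integral_Ioi_mul_exp_neg_sq_div (c := 4) (by norm_num) hr).1]
  ring

/-! ### The kernel weight -/

/-- `Φ(r)⁻¹ · r e^{−r²/4} = 4(1 − e^{−r²/4})/r` for `r ≠ 0` (`Φ⁻¹ = (eˢ − 1)/s`, `s = r²/4`):
`A a⋆ = B₁ a⋆` for the `k = 1` mode operator. [folklore] -/
theorem am1_inv_kerWeight_mul_aStar {r : ℝ} (hr : r ≠ 0) :
    (kerWeight r)⁻¹ * (r * Real.exp (-(r ^ 2 / 4))) = 4 * (1 - Real.exp (-(r ^ 2 / 4))) / r := by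
  rw [kerWeight_eq hr, inv_div, Real.exp_neg]
  have hE : Real.exp (r ^ 2 / 4) ≠ 0 := (Real.exp_pos _).ne'
  field_simp

/-- `Φ(r) ≤ (r²/4) e^{−r²/4} + e^{−3r²/8}` (`Φ = s e^{−s} + e^{−s}Φ`, `Φ ≤ e^{−s/2}`, `s = r²/4`). [folklore] -/
theorem am1_kerWeight_le_add (r : ℝ) :
    kerWeight r ≤ r ^ 2 / 4 * Real.exp (-(r ^ 2 / 4)) + Real.exp (-(3 * r ^ 2 / 8)) := by
  rcases eq_or_ne r 0 with h | h
  · subst h; simp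
  have hid : kerWeight r = r ^ 2 / 4 * Real.exp (-(r ^ 2 / 4)) + Real.exp (-(r ^ 2 / 4)) * kerWeight r := by
    rw [kerWeight_eq h, Real.exp_neg]
    have hs : 0 < r ^ 2 / 4 := by positivity
    have hE : Real.exp (r ^ 2 / 4) ≠ 0 := (Real.exp_pos _).ne'
    have hne : Real.exp (r ^ 2 / 4) - 1 ≠ 0 := by
      have : 1 < Real.exp (r ^ 2 / 4) := Real.one_lt_exp_iff.2 hs; linarith
    field_simp
    ring
  have h2 : Real.exp (-(r ^ 2 / 4)) * kerWeight r ≤ Real.exp (-(3 * r ^ 2 / 8)) := by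
    calc Real.exp (-(r ^ 2 / 4)) * kerWeight r ≤ Real.exp (-(r ^ 2 / 4)) * Real.exp (-(r ^ 2 / 8)) :=
          mul_le_mul_of_nonneg_left (kerWeight_le_exp r) (Real.exp_pos _).le
      _ = Real.exp (-(3 * r ^ 2 / 8)) := by rw [← Real.exp_add]; ring_nf
  linarith

/-- **The trace bound `∫₀^∞ r Φ(r) dr ≤ 10/3`** (true value `2ζ(2) = π²/3 ≈ 3.29`): with
`Φ ≤ (r²/4)e^{−r²/4} + e^{−3r²/8}`, `∫ r³/4 · e^{−r²/4} = 2` and `∫ r e^{−3r²/8} = 4/3`. This is the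
numerical input `tr B̃₁ = ½∫ rΦ < 2` of the trace argument. [folklore] -/
theorem am1_integral_mul_kerWeight_le : ∫ r in Ioi (0 : ℝ), r * kerWeight r ≤ 10 / 3 := by
  obtain ⟨h3v, h3i⟩ := am1_integral_Ioi_pow_three_mul_exp (c := 4) (by norm_num)
  obtain ⟨h1v, h1i⟩ := integral_Ioi_mul_exp_neg_sq_div (c := 8 / 3) (by norm_num) (le_refl (0 : ℝ))
  have h1v' : (∫ ρ in Ioi (0 : ℝ), ρ * Real.exp (-(3 * ρ ^ 2 / 8))) = 4 / 3 := by
    have : (fun ρ : ℝ => ρ * Real.exp (-(3 * ρ ^ 2 / 8))) = fun ρ : ℝ => ρ * Real.exp (-(ρ ^ 2 / (8 / 3))) := by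
      funext ρ; congr 2; field_simp
    rw [this, h1v]; norm_num
  have h1i' : IntegrableOn (fun ρ : ℝ => ρ * Real.exp (-(3 * ρ ^ 2 / 8))) (Ioi 0) := by
    refine h1i.congr_fun (fun ρ _ => ?_) measurableSet_Ioi
    simp only; congr 2; field_simp
  calc (∫ r in Ioi (0 : ℝ), r * kerWeight r)
      ≤ ∫ r in Ioi (0 : ℝ), ((1 / 4) * (r ^ 3 * Real.exp (-(r ^ 2 / 4))) + r * Real.exp (-(3 * r ^ 2 / 8))) := by
        refine setIntegral_mono_on integrableOn_mul_kerWeight ((h3i.const_mul _).add h1i')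
          measurableSet_Ioi fun r hr => ?_
        have h := am1_kerWeight_le_add r
        have hr0 : 0 ≤ r := le_of_lt hr
        calc r * kerWeight r ≤ r * (r ^ 2 / 4 * Real.exp (-(r ^ 2 / 4)) + Real.exp (-(3 * r ^ 2 / 8))) :=
              mul_le_mul_of_nonneg_left h hr0
          _ = _ := by ring
    _ = (1 / 4) * (4 ^ 2 / 2) + 4 / 3 := by
        rw [integral_add (h3i.const_mul _) h1i', MeasureTheory.integral_const_mul, h3v, h1v']
    _ = 10 / 3 := by norm_num

/-- `∫₀^∞ r³ Φ(r) dr ≤ 32` (`Φ ≤ e^{−r²/8}`, `∫ r³e^{−r²/8} = 32`; true value `16ζ(3) ≈ 19.2`), with the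
integrability of `r³Φ` on `(0, ∞)`. [folklore] -/
theorem am1_integral_pow_three_mul_kerWeight_le :
    (∫ r in Ioi (0 : ℝ), r ^ 3 * kerWeight r) ≤ 32 ∧
      IntegrableOn (fun r : ℝ => r ^ 3 * kerWeight r) (Ioi 0) := by
  obtain ⟨hv, hi⟩ := am1_integral_Ioi_pow_three_mul_exp (c := 8) (by norm_num)
  have hle : ∀ r ∈ Ioi (0 : ℝ), r ^ 3 * kerWeight r ≤ r ^ 3 * Real.exp (-(r ^ 2 / 8)) := fun r hr =>
    mul_le_mul_of_nonneg_left (kerWeight_le_exp r) (pow_nonneg (le_of_lt hr) 3)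
  have hint : IntegrableOn (fun r : ℝ => r ^ 3 * kerWeight r) (Ioi 0) := by
    refine Integrable.mono' hi (((continuous_pow 3).mul continuous_kerWeight).aestronglyMeasurable) ?_
    refine (ae_restrict_iff' measurableSet_Ioi).2 (Eventually.of_forall fun r hr => ?_)
    rw [Real.norm_of_nonneg (mul_nonneg (pow_nonneg (le_of_lt hr) 3) (kerWeight_pos r).le)]
    exact hle r hr
  refine ⟨?_, hint⟩
  calc (∫ r in Ioi (0 : ℝ), r ^ 3 * kerWeight r) ≤ ∫ r in Ioi (0 : ℝ), r ^ 3 * Real.exp (-(r ^ 2 / 8)) :=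
        setIntegral_mono_on hint hi measurableSet_Ioi hle
    _ = 32 := by rw [hv]; norm_num

/-! ### The registered tools stub -/

/-- **Registered tools stub `stub_arnoldModeOne1DToolsA`** (helpers for `stub_arnoldModeOne1D`, line
`Sketch` of crux `CoreLinearInvertibility`, stmt-NavierStokesRegularity-17973): absorption of polynomial
weights by Gaussians, the kernel-weight facts `Φ⁻¹ ≤ e^{r²/4}` (tree), `Φ⁻¹ · r e^{−r²/4} = 4(1 − e^{−r²/4})/r`,
`Φ ≤ (r²/4)e^{−r²/4} + e^{−3r²/8}`, the trace bound `∫ rΦ ≤ 10/3`, `∫ r³Φ ≤ 32`, and the explicit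
integrals `∫₀^∞ ρ³e^{−ρ²/c} = c²/2`, `∫₀ʳ s³e^{−s²/4} = 8 − 2(r²+4)e^{−r²/4}`. [folklore] -/
theorem stub_arnoldModeOne1DToolsA :
    (∀ (N : ℕ) (r : ℝ), 0 ≤ r → (1 + r) ^ N * Real.exp (-(r ^ 2 / 8)) ≤ Real.exp (2 * (N : ℝ) ^ 2)) ∧
    (∀ r : ℝ, (kerWeight r)⁻¹ ≤ Real.exp (r ^ 2 / 4)) ∧
    (∀ r : ℝ, r ≠ 0 →
      (kerWeight r)⁻¹ * (r * Real.exp (-(r ^ 2 / 4))) = 4 * (1 - Real.exp (-(r ^ 2 / 4))) / r) ∧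
    (∀ r : ℝ, kerWeight r ≤ r ^ 2 / 4 * Real.exp (-(r ^ 2 / 4)) + Real.exp (-(3 * r ^ 2 / 8))) ∧
    (∫ r in Set.Ioi (0 : ℝ), r * kerWeight r ≤ 10 / 3) ∧
    ((∫ r in Set.Ioi (0 : ℝ), r ^ 3 * kerWeight r) ≤ 32) ∧
    (∀ c : ℝ, 0 < c → (∫ ρ in Set.Ioi (0 : ℝ), ρ ^ 3 * Real.exp (-(ρ ^ 2 / c))) = c ^ 2 / 2) ∧
    (∀ r : ℝ, ∫ s in (0 : ℝ)..r, s ^ 2 * (s * Real.exp (-(s ^ 2 / 4))) =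
      8 - 2 * (r ^ 2 + 4) * Real.exp (-(r ^ 2 / 4))) :=
  ⟨fun N _ hr => am1_one_add_pow_mul_exp_le N hr, arnold_inv_kerWeight_le,
    fun _ hr => am1_inv_kerWeight_mul_aStar hr, am1_kerWeight_le_add, am1_integral_mul_kerWeight_le,
    am1_integral_pow_three_mul_kerWeight_le.1, fun _ hc => (am1_integral_Ioi_pow_three_mul_exp hc).1,
    am1_integral_sq_mul_aStar⟩

end Summit.NavierStokesRegularity.NavierStokesRegularity.Theorems
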